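import Mathlib
import HarnessLib
import Literature.Computability.AlgebraicComplexity.GLAnnihilator

/-!
# Route SchenstedIndex — the annihilator of the power trace `tr(X³)` contains the commutators

Towards the calibration rung `BorderPcPerThree` (stmt-ValiantsHypothesis-16085) by ORBIT DIMENSIONS:
for the cubic `Q_n = tr(X³)` of the generic `n × n` matrix `X` (a form on `W = ℂ^(n×n)`), every
`M ∈ 𝔤𝔩_n` gives an element `Z(M) ∈ 𝔤𝔩(W)` — the vector field `X ↦ M X − X M` — annihilating `Q_n`
(`comm_mem_glAnn_tracePow_three`: `d/dε tr((X + ε[M,X])³) = 3 tr([M,X] X²) = 0` by cyclicity), and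
`M ↦ Z(M)` has kernel the scalar matrices, so `dim 𝔤𝔩(W)_{Q_n} ≥ n² − 1`
(`sq_sub_one_le_finrank_glAnn_tracePow_three`); in particular `dim 𝔤𝔩(ℂ⁹)_{tr X_3³} ≥ 8`.
Route-independent (no `Theses` import).

HONEST FRAMING: elementary bookkeeping (derivations and trace cyclicity); nothing here bears on
`VP ≠ VNP`.
-/

set_option linter.dupNamespace false

noncomputable section

namespace Summit.ValiantsHypothesis.ValiantsHypothesis.Theorems.SchenstedIndex

open MvPolynomial Matrix
open Literature.Computability.AlgebraicComplexity

/-! ## Derivations act on matrices of polynomials entrywise -/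

/-- `∑_b ℓ_b · ∂_b P` is the derivation with values `ℓ_b` on the variables (`mkDerivation`). -/
theorem sum_mul_pderiv_eq_mkDerivation {σ R : Type*} [Fintype σ] [DecidableEq σ] [CommRing R]
    (ℓ : σ → MvPolynomial σ R) (P : MvPolynomial σ R) :
    ∑ b, ℓ b * pderiv b P = mkDerivation R ℓ P := by
  induction P using MvPolynomial.induction_on with
  | C a => simp [mkDerivation]
  | add p q hp hq => simp only [map_add, mul_add, Finset.sum_add_distrib, hp, hq]
  | mul_X p i hp =>
      rw [Derivation.leibniz, mkDerivation_X, ← hp, smul_eq_mul, smul_eq_mul]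
      simp only [Derivation.leibniz, smul_eq_mul, pderiv_X, mul_add, Finset.sum_add_distrib]
      congr 1
      · rw [Finset.sum_eq_single i]
        · rw [Pi.single_eq_same, mul_one, mul_comm]
        · intro b _ hb
          rw [Pi.single_eq_of_ne (Ne.symm hb), mul_zero, mul_zero]
        · intro h; exact absurd (Finset.mem_univ i) h
      · rw [Finset.mul_sum]
        refine Finset.sum_congr rfl fun b _ => ?_
        ring

/-- Leibniz rule for an entrywise derivation on a product of matrices. -/
theorem map_mul_derivation {ι A R : Type*} [Fintype ι] [CommRing R] [CommRing A] [Algebra R A]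
    (D : Derivation R A A) (P Q : Matrix ι ι A) :
    (P * Q).map D = P.map D * Q + P * Q.map D := by
  ext i j
  simp only [Matrix.map_apply, Matrix.mul_apply, Matrix.add_apply, map_sum, Derivation.leibniz,
    smul_eq_mul, Finset.sum_add_distrib]
  rw [add_comm]
  refine congrArg₂ (· + ·) (Finset.sum_congr rfl fun k _ => ?_) (Finset.sum_congr rfl fun k _ => ?_)
    <;> ring

/-- A derivation passes through the trace. -/
theorem derivation_trace {ι A R : Type*} [Fintype ι] [CommRing R] [CommRing A] [Algebra R A]
    (D : Derivation R A A) (P : Matrix ι ι A) : D P.trace = (P.map D).trace := by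
  simp only [Matrix.trace, Matrix.diag, map_sum, Matrix.map_apply]

/-! ## The commutator vector fields annihilate `tr(X³)` -/

/-- The linear vector field of `Z(M)`: `∑_a Z(M)_{a,b} x_a = (M X − X M)_b` (with `M` constant). -/
theorem sum_commField_smul_X {n : ℕ} (M : Matrix (Fin n) (Fin n) ℂ) (b : Fin n × Fin n) :
    (∑ a : Fin n × Fin n,
        ((if a.2 = b.2 then M b.1 a.1 else 0) - (if a.1 = b.1 then M a.2 b.2 else 0)) •
          (X a : MvPolynomial (Fin n × Fin n) ℂ)) =
      (M.map (C : ℂ → MvPolynomial (Fin n × Fin n) ℂ) * Matrix.mvPolynomialX (Fin n) (Fin n) ℂ -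
        Matrix.mvPolynomialX (Fin n) (Fin n) ℂ * M.map (C : ℂ → MvPolynomial (Fin n × Fin n) ℂ))
        b.1 b.2 := by
  simp only [sub_smul, Finset.sum_sub_distrib, ite_smul, zero_smul]
  rw [Matrix.sub_apply, Matrix.mul_apply, Matrix.mul_apply]
  congr 1
  · rw [Fintype.sum_prod_type]
    simp only [Finset.sum_ite_eq', Finset.mem_univ, if_true]
    refine Finset.sum_congr rfl fun k _ => ?_
    rw [Matrix.map_apply, Matrix.mvPolynomialX_apply, smul_eq_C_mul]
  · rw [Fintype.sum_prod_type]
    rw [Finset.sum_eq_single b.1]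
    · simp only [if_true]
      refine Finset.sum_congr rfl fun k _ => ?_
      rw [Matrix.map_apply, Matrix.mvPolynomialX_apply, smul_eq_C_mul, mul_comm]
    · intro i _ hi
      simp [hi]
    · intro h; exact absurd (Finset.mem_univ _) h

/-- **`Z(M) · tr(X³) = 0`**: the commutator vector field `X ↦ M X − X M` annihilates the power
trace (`tr` of `D(X³) = [M,X] X² + X [M,X] X + X² [M,X]` vanishes by cyclicity of the trace). -/
theorem comm_mem_glAnn_tracePow_three {n : ℕ} (M : Matrix (Fin n) (Fin n) ℂ) :
    (Matrix.of fun a b : Fin n × Fin n =>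
        (if a.2 = b.2 then M b.1 a.1 else 0) - (if a.1 = b.1 then M a.2 b.2 else 0)) ∈
      glAnn ((Matrix.mvPolynomialX (Fin n) (Fin n) ℂ ^ 3).trace) := by
  set X := Matrix.mvPolynomialX (Fin n) (Fin n) ℂ with hX
  set CM : Matrix (Fin n) (Fin n) (MvPolynomial (Fin n × Fin n) ℂ) :=
    M.map (C : ℂ → MvPolynomial (Fin n × Fin n) ℂ) with hCM
  rw [mem_glAnn_iff_glTangentMap_eq_zero, glTangentMap_eq_sum_mul_pderiv]
  simp only [Matrix.of_apply]
  simp_rw [sum_commField_smul_X M]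
  rw [sum_mul_pderiv_eq_mkDerivation]
  set D := mkDerivation ℂ (fun b : Fin n × Fin n => (CM * X - X * CM) b.1 b.2) with hD
  have hDX : X.map D = CM * X - X * CM := by
    ext i j
    rw [Matrix.map_apply, hX, Matrix.mvPolynomialX_apply, hD, mkDerivation_X]
  rw [derivation_trace, pow_three, map_mul_derivation, map_mul_derivation, hDX]
  simp only [Matrix.mul_sub, Matrix.sub_mul, Matrix.mul_add, Matrix.mul_assoc, Matrix.trace_add,
    Matrix.trace_sub]
  -- cyclicity: `tr(M X³) = tr(X³ M)`
  have hc : (CM * (X * (X * X))).trace = (X * (X * (X * CM))).trace := by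
    rw [Matrix.trace_mul_comm, Matrix.mul_assoc, Matrix.mul_assoc]
  rw [hc]
  ring

/-! ## The commutator family has dimension `n² − 1` -/

/-- **`dim 𝔤𝔩(W)_{tr X³} ≥ n² − 1`**: the linear map `M ↦ Z(M)` lands in the annihilator and its
kernel consists of scalar matrices. -/
theorem sq_sub_one_le_finrank_glAnn_tracePow_three (n : ℕ) :
    n ^ 2 - 1 ≤ Module.finrank ℂ (glAnn ((Matrix.mvPolynomialX (Fin n) (Fin n) ℂ ^ 3).trace)) := by
  classical
  -- the linear map `Z`
  let Zmap : Matrix (Fin n) (Fin n) ℂ →ₗ[ℂ] Matrix (Fin n × Fin n) (Fin n × Fin n) ℂ :=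
    { toFun := fun M => Matrix.of fun a b : Fin n × Fin n =>
        (if a.2 = b.2 then M b.1 a.1 else 0) - (if a.1 = b.1 then M a.2 b.2 else 0)
      map_add' := fun M N => by
        ext a b
        simp only [Matrix.of_apply, Matrix.add_apply]
        split_ifs <;> ring
      map_smul' := fun c M => by
        ext a b
        simp only [Matrix.of_apply, Matrix.smul_apply, smul_eq_mul, RingHom.id_apply]
        split_ifs <;> ring }
  have hrange : LinearMap.range Zmap ≤ glAnn ((Matrix.mvPolynomialX (Fin n) (Fin n) ℂ ^ 3).trace) := by
    rintro _ ⟨M, rfl⟩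
    exact comm_mem_glAnn_tracePow_three M
  -- the kernel is contained in the scalars
  have hker : LinearMap.ker Zmap ≤ Submodule.span ℂ {(1 : Matrix (Fin n) (Fin n) ℂ)} := by
    intro M hM
    rw [LinearMap.mem_ker] at hM
    have hentry : ∀ a b : Fin n × Fin n,
        ((if a.2 = b.2 then M b.1 a.1 else 0) - (if a.1 = b.1 then M a.2 b.2 else 0) : ℂ) = 0 :=
      fun a b => by
        have := congr_fun (congr_fun hM a) b
        simpa [Zmap] using this
    rcases Nat.eq_zero_or_pos n with hn | hn
    · subst hn
      have : M = 0 := by ext i; exact i.elim0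
      rw [this]; exact Submodule.zero_mem _
    · obtain ⟨i₀⟩ : Nonempty (Fin n) := ⟨⟨0, hn⟩⟩
      rw [Submodule.mem_span_singleton]
      refine ⟨M i₀ i₀, ?_⟩
      ext r k
      rw [Matrix.smul_apply, smul_eq_mul]
      by_cases hrk : r = k
      · subst hrk
        have h := hentry (r, i₀) (r, i₀)
        rw [if_pos rfl, if_pos rfl] at h
        dsimp only at h
        rw [Matrix.one_apply_eq, mul_one]
        exact (sub_eq_zero.1 h).symm
      · have h := hentry (k, i₀) (r, i₀)
        rw [if_pos rfl, if_neg (Ne.symm hrk), sub_zero] at h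
        dsimp only at h
        rw [Matrix.one_apply_ne hrk, mul_zero]
        exact h.symm
  have hrn := LinearMap.finrank_range_add_finrank_ker Zmap
  rw [Module.finrank_matrix, Module.finrank_self, mul_one, Fintype.card_fin] at hrn
  have hk : Module.finrank ℂ (LinearMap.ker Zmap) ≤ 1 :=
    (Submodule.finrank_mono hker).trans ((finrank_span_le_card _).trans (by simp))
  have hr : Module.finrank ℂ (LinearMap.range Zmap) ≤
      Module.finrank ℂ (glAnn ((Matrix.mvPolynomialX (Fin n) (Fin n) ℂ ^ 3).trace)) :=
    Submodule.finrank_mono hrange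
  have : n ^ 2 = n * n := sq n
  omega

end Summit.ValiantsHypothesis.ValiantsHypothesis.Theorems.SchenstedIndex

end
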